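import Summits.Parity.GeneralizedHardyLittlewood.Theorems.LeeYangFibresCellParityLawKernelDefs
import Summits.Parity.GeneralizedHardyLittlewood.Theorems.LeeYangFibresCellParityLawModelDensityBounds
import Literature.NumberTheory.Sieve.RoughOmegaCellsAsymptoticDensity
import Literature.NumberTheory.Sieve.RoughOmegaCellsLocalAPPrep
import Literature.NumberTheory.Sieve.RoughCellDensity
import HarnessLib

/-!
# Route `LeeYangFibres`, crux `CellParityLaw` (stmt-Parity-14109), line `section-annihilator`:
# the registered stub `stub_modelDensityAlladi` — Alladi's densities with a rate

We prove `ModelDensityAlladi` (vocabulary file `LeeYangFibresCellParityLawKernelDefs`, skeleton v13):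
for fixed `u ≥ 2` there are `C ≥ 0` and `N₀` with

* `|a_m - I_m(u)/log N| ≤ C/log² N` for all `N ≥ N₀` and all `m ≥ 1`, where
  `a_m = modelDensity N u m = #{n ≤ N : P⁻(n) > N^{1/u}, Ω(n) = m}/N` and `I_m = roughCellDensity m`
  are the Alladi–Buchstab cell densities;
* `|I_m(v) - I_m(u)| ≤ C (v - u)` for `m ≥ 1` and `u ≤ v ≤ u + 1`.

Proof. The Lipschitz clause (with constant `1`, on all of `[1, ∞)`) is the tree's
`RoughCellsLocal.roughCellDensity_sub_le_sub` (`I_j' = I_{j-1}(· - 1)/(· - 1) ∈ [0, 1]`); monotonicity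
(`monotone_roughCellDensity`) removes the absolute value.
The density clause: for `m ≥ u` both `a_m` (`modelDensity_eq_zero`) and `I_m(u)`
(`roughCellDensity_of_le`) vanish. For `1 ≤ m < u` the tree's Alladi theorem with rate
`exists_abs_roughCell_sub_main_le` (K. Alladi, Quart. J. Math. Oxford (2) 33 (1982), Thm 1) at
`X = N`, `Y = ⌊N^{1/u}⌋ + 1`, `k = u` gives
`|N a_m - (N I_m(u')/log N - [m = 1] Y/log Y)| ≤ C_m N/log² Y`, `u' = log N/log Y ∈ [u - u²/log N, u]`
(`log Y - log N^{1/u} ≤ 1/N^{1/u} ≤ 1`); here `log Y ≥ (log N)/u`, `Y/log Y ≤ 2u² N/log² N`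
(`log r ≤ r - 1`, `r = N^{1/u}`, `r² ≤ N`), and the Lipschitz clause moves `I_m(u')` to `I_m(u)` at the
cost `u² N/log² N`; the constant is `(∑_{m<u} C_m + 3) u² + 1`.

References: K. Alladi, *The distribution of ν(n) in the sieve of Eratosthenes*, Quart. J. Math.
Oxford (2) 33 (1982) 129–148, Theorem 1 [Alladi1982]; G. Tenenbaum, *Introduction to analytic and
probabilistic number theory*, III.6 [Tenenbaum2015].
-/

noncomputable section

open scoped BigOperators Classical
open Finset Filter Literature.NumberTheory.Sieve

namespace Summit.Parity.GeneralizedHardyLittlewood.Cruxes.CellParityLaw.SectionAnnihilator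

namespace ModelDensityAlladiAux

/-! ## Lipschitz continuity of the cell densities -/

/-- `|I_m(b) - I_m(a)| ≤ b - a` for `m ≥ 1` and `1 ≤ a ≤ b` (monotonicity, `monotone_roughCellDensity`,
and the `1`-Lipschitz bound `RoughCellsLocal.roughCellDensity_sub_le_sub` of the tree). -/
theorem abs_sub_le {m : ℕ} (hm : 1 ≤ m) {a b : ℝ} (ha : 1 ≤ a) (hab : a ≤ b) :
    |roughCellDensity m b - roughCellDensity m a| ≤ b - a := by
  rw [abs_of_nonneg (sub_nonneg.2 (monotone_roughCellDensity m hab))]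
  exact RoughCellsLocal.roughCellDensity_sub_le_sub hm ha hab

/-! ## Alladi with rate for the bulk cells `1 ≤ m < u` -/

/-- **Alladi with rate for the model densities.** For `u ≥ 2` there are `C ≥ 0` and `N₀` with
`|a_m - I_m(u)/log N| ≤ C/log² N` for all `N ≥ N₀` and `1 ≤ m < u`: the tree's
`exists_abs_roughCell_sub_main_le` at `X = N`, `Y = ⌊N^{1/u}⌋ + 1`, `k = u`, the bounds
`log Y ≥ (log N)/u`, `Y/log Y ≤ 2u² N/log² N`, and `0 ≤ I_m(u) - I_m(u') ≤ u - u' ≤ u²/log N` for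
`u' = log N/log Y`. -/
theorem bulk {u : ℕ} (hu : 2 ≤ u) :
    ∃ C : ℝ, 0 ≤ C ∧ ∃ N₀ : ℕ, ∀ N : ℕ, N₀ ≤ N → ∀ m : ℕ, 1 ≤ m → m < u →
      |modelDensity N u m - roughCellDensity m u / Real.log N| ≤ C / Real.log N ^ 2 := by
  choose C hC0 hC using fun i : ℕ => exists_abs_roughCell_sub_main_le i u
  set Cs : ℝ := ∑ i ∈ Finset.range u, C i with hCs
  have hCs0 : 0 ≤ Cs := Finset.sum_nonneg fun i _ => hC0 i
  have hCi : ∀ i < u, C i ≤ Cs := fun i hi =>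
    Finset.single_le_sum (f := C) (fun i _ => hC0 i) (Finset.mem_range.2 hi)
  have hu0 : (0 : ℝ) < u := by exact_mod_cast (by omega : 0 < u)
  have hT : Tendsto (fun N : ℕ => (N : ℝ) ^ ((1 : ℝ) / u)) atTop atTop :=
    (tendsto_rpow_atTop (by positivity)).comp tendsto_natCast_atTop_atTop
  obtain ⟨N₀, hN₀⟩ := Filter.eventually_atTop.1
    ((hT.eventually_ge_atTop 2).and (eventually_ge_atTop 2))
  refine ⟨(Cs + 3) * u ^ 2, by positivity, N₀, fun N hN m hm hmu => ?_⟩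
  obtain ⟨hr2, hN2⟩ := hN₀ N hN
  obtain ⟨i, rfl⟩ : ∃ i, m = i + 1 := ⟨m - 1, by omega⟩
  have hiu : i < u := by omega
  have hN0 : (0 : ℝ) < N := by exact_mod_cast (by omega : 0 < N)
  have hN1 : (1 : ℝ) < N := by exact_mod_cast (by omega : 1 < N)
  have hlogN : 0 < Real.log N := Real.log_pos hN1
  rw [modelDensity_eq_card_div (Nat.succ_pos i)]
  -- the threshold `r = N^{1/u}` and `Y = ⌊r⌋ + 1`
  set r : ℝ := (N : ℝ) ^ ((1 : ℝ) / u) with hr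
  change 2 ≤ r at hr2
  have hr0 : 0 < r := by linarith
  have hr1 : 1 ≤ r := by linarith
  have hrpow : r ^ u = N := by
    rw [hr, one_div]
    exact Real.rpow_inv_natCast_pow hN0.le (by omega)
  have hr2N : r ^ 2 ≤ N := by
    rw [← hrpow]
    exact pow_le_pow_right₀ hr1 hu
  have hlogr : Real.log r = Real.log N / u := by
    rw [hr, Real.log_rpow hN0]
    ring
  have hlogr' : Real.log N = u * Real.log r := by
    rw [hlogr]
    field_simp
  set Yn : ℕ := ⌊r⌋₊ + 1 with hYn
  set Y : ℝ := (Yn : ℝ) with hY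
  have hYr : r < Y := by
    rw [hY, hYn]
    push_cast
    exact Nat.lt_floor_add_one r
  have hYle : Y ≤ r + 1 := by
    rw [hY, hYn]
    push_cast
    linarith [Nat.floor_le hr0.le]
  have hY2 : (2 : ℝ) ≤ Y := by linarith
  have hY0 : 0 < Y := by linarith
  have hYN : Y ≤ N := by nlinarith
  have hlogY : 0 < Real.log Y := Real.log_pos (by linarith)
  have hlogYge : Real.log N / u ≤ Real.log Y := by
    rw [← hlogr]
    exact Real.log_le_log hr0 hYr.le
  have hlogYle : Real.log Y ≤ Real.log N := Real.log_le_log hY0 hYN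
  have hk : Real.log (N : ℝ) ≤ (u : ℕ) * Real.log Y := (div_le_iff₀' hu0).1 hlogYge
  -- Alladi
  have hA := hC i (N : ℝ) Y hY2 hYN hk
  have hceil : ⌈Y⌉₊ = Yn := by rw [hY, Nat.ceil_natCast]
  have hfloor : ⌊(N : ℝ)⌋₊ = N := Nat.floor_natCast N
  rw [hceil, hfloor] at hA
  set A : ℝ := ((((roughIcc Yn N).filter
    (fun b => ArithmeticFunction.cardFactors b = i + 1)).card : ℕ) : ℝ) with hAdef
  set L : ℝ := Real.log N with hL
  set I : ℝ := roughCellDensity (i + 1) (u : ℝ) with hIdef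
  set I' : ℝ := roughCellDensity (i + 1) (L / Real.log Y) with hI'def
  -- (1) the error term `C_i N/log² Y ≤ C_i u² N/log² N ≤ Cs u² N/log² N`
  have hCi0 : 0 ≤ C i := hC0 i
  have h1 : C i * N / Real.log Y ^ 2 ≤ Cs * u ^ 2 * N / L ^ 2 := by
    calc C i * N / Real.log Y ^ 2 ≤ C i * N / (L / u) ^ 2 :=
          div_le_div_of_nonneg_left (by positivity) (by positivity) (by gcongr)
      _ = C i * u ^ 2 * N / L ^ 2 := by
          field_simp
      _ ≤ Cs * u ^ 2 * N / L ^ 2 := by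
          gcongr
          exact hCi i hiu
  -- (2) the prime correction `[i = 0] Y/log Y ≤ 2u² N/log² N`
  have hrL : r * L ≤ u * N := by
    have hlog1 : Real.log r ≤ r - 1 := Real.log_le_sub_one_of_pos hr0
    have hrr : r * (r - 1) ≤ N := by nlinarith
    calc r * L = u * (r * Real.log r) := by rw [hlogr']; ring
      _ ≤ u * (r * (r - 1)) := by gcongr
      _ ≤ u * N := by gcongr
  have hYlog : Y / Real.log Y ≤ 2 * u ^ 2 * N / L ^ 2 := by
    calc Y / Real.log Y ≤ 2 * r / (L / u) := div_le_div₀ (by positivity) (by linarith) (by positivity) hlogYge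
      _ = 2 * u * r / L := by
          field_simp
      _ ≤ 2 * u ^ 2 * N / L ^ 2 := by
          rw [div_le_div_iff₀ hlogN (by positivity)]
          have h := mul_le_mul_of_nonneg_left hrL (by positivity : (0 : ℝ) ≤ 2 * u * L)
          calc 2 * u * r * L ^ 2 = 2 * u * L * (r * L) := by ring
            _ ≤ 2 * u * L * (u * N) := h
            _ = 2 * u ^ 2 * N * L := by ring
  have hcorr0 : 0 ≤ (if i = 0 then Y / Real.log Y else 0) := by
    split_ifs
    · positivity
    · exact le_rfl
  have hcorr1 : (if i = 0 then Y / Real.log Y else 0) ≤ 2 * u ^ 2 * N / L ^ 2 := by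
    split_ifs
    · exact hYlog
    · positivity
  -- (3) moving `I_m(u')` to `I_m(u)`: `0 ≤ I - I' ≤ u - u' ≤ u²/log N`
  have hu'1 : 1 ≤ L / Real.log Y := by
    rw [le_div_iff₀ hlogY, one_mul]
    exact hlogYle
  have hu'u : L / Real.log Y ≤ u := by
    rw [div_le_iff₀ hlogY]
    exact hk
  have hII' : I' ≤ I := monotone_roughCellDensity _ hu'u
  have hgap : (u : ℝ) - L / Real.log Y ≤ u ^ 2 / L := by
    have hnum : u * Real.log Y - L ≤ u := by
      have hdiff : Real.log Y - Real.log r ≤ 1 := by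
        have h := Real.log_le_sub_one_of_pos (show 0 < Y / r by positivity)
        rw [Real.log_div hY0.ne' hr0.ne'] at h
        have h' : Y / r - 1 ≤ 1 := by
          rw [div_sub_one hr0.ne', div_le_one hr0]
          linarith
        linarith
      rw [hlogr']
      nlinarith
    calc (u : ℝ) - L / Real.log Y = (u * Real.log Y - L) / Real.log Y := by
          field_simp
      _ ≤ u / Real.log Y := div_le_div_of_nonneg_right hnum hlogY.le
      _ ≤ u / (L / u) := div_le_div_of_nonneg_left hu0.le (by positivity) hlogYge
      _ = u ^ 2 / L := by
          field_simp
  have hIgap : I - I' ≤ u ^ 2 / L :=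
    (RoughCellsLocal.roughCellDensity_sub_le_sub (Nat.succ_pos i) hu'1 hu'u).trans hgap
  have h3 : N * I' / L ≤ N * I / L := by gcongr
  have h3' : N * I / L - N * I' / L ≤ u ^ 2 * N / L ^ 2 := by
    calc N * I / L - N * I' / L = N / L * (I - I') := by ring
      _ ≤ N / L * (u ^ 2 / L) := by gcongr
      _ = u ^ 2 * N / L ^ 2 := by
          field_simp
  -- assembling
  have hsplit : (Cs + 3) * u ^ 2 * N / L ^ 2 =
      Cs * u ^ 2 * N / L ^ 2 + 2 * u ^ 2 * N / L ^ 2 + u ^ 2 * N / L ^ 2 := by ring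
  have key : |A - N * I / L| ≤ (Cs + 3) * u ^ 2 * N / L ^ 2 := by
    rw [hsplit, abs_le]
    obtain ⟨hA1, hA2⟩ := abs_le.1 hA
    constructor <;> linarith
  have e : A / N - I / L = (A - N * I / L) / N := by
    field_simp
  rw [e, abs_div, abs_of_pos hN0, div_le_iff₀ hN0]
  calc |A - N * I / L| ≤ (Cs + 3) * u ^ 2 * N / L ^ 2 := key
    _ = (Cs + 3) * u ^ 2 / L ^ 2 * N := by ring

end ModelDensityAlladiAux

/-! ## The registered stub -/

open ModelDensityAlladiAux in
/-- **`stub_modelDensityAlladi`** (registered stub of the line `section-annihilator`, skeleton v13):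
Alladi's densities with rate, `|a_m - I_m(u)/log N| ≤ C/log² N` for `m ≥ 1`, `N ≥ N₀` (bulk cells by
`ModelDensityAlladiAux.bulk`, top cells `m ≥ u` vanish on both sides), and the Lipschitz bound
`|I_m(v) - I_m(u)| ≤ C (v - u)` on `[u, u + 1]` (`ModelDensityAlladiAux.abs_sub_le`, constant `1 ≤ C`). -/
theorem stub_modelDensityAlladi : ModelDensityAlladi := by
  intro u hu
  obtain ⟨C, hC0, N₀, hC⟩ := bulk hu
  refine ⟨C + 1, by positivity, N₀, fun N hN m hm => ?_, fun m hm v huv _ => ?_⟩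
  · rcases lt_or_ge m u with hmu | hmu
    · calc |modelDensity N u m - roughCellDensity m u / Real.log N| ≤ C / Real.log N ^ 2 :=
            hC N hN m hm hmu
        _ ≤ (C + 1) / Real.log N ^ 2 := by
            gcongr
            linarith
    · rw [modelDensity_eq_zero (by omega) hmu,
        roughCellDensity_of_le (by omega) (by exact_mod_cast hmu), zero_div, sub_zero, abs_zero]
      positivity
  · have hu1 : (1 : ℝ) ≤ u := by exact_mod_cast (by omega : 1 ≤ u)
    calc |roughCellDensity m v - roughCellDensity m u| ≤ v - u := abs_sub_le hm hu1 huv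
      _ = 1 * (v - u) := (one_mul _).symm
      _ ≤ (C + 1) * (v - u) := mul_le_mul_of_nonneg_right (by linarith) (by linarith)

end Summit.Parity.GeneralizedHardyLittlewood.Cruxes.CellParityLaw.SectionAnnihilator

end
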